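import Summits.Ventures.HodgeRepro2.T5SU11FibrationCartan
import Summits.Ventures.HodgeRepro2.T5RuhlRadial

/-!
# The `L²`-integral of the lowest-weight-`3` matrix coefficient against the Haar measure

The support map's P2′ reads `|⟨π(g) f, f⟩| = ‖f‖² cosh(η/2)⁻³` for `g = z · u(ψ₁) d(η) u(ψ₂)`
(printed input) and then integrates: with `cosh(η/2)⁻² = 1 - |g·0|²` in the disc picture, the
function is `‖f‖⁴ (1 - |g·0|²)³`.  Here its integral against ANY Haar measure `μ` of `SU(1,1)` is
computed through the fibration theorem: `c • ∫_G (1 - |g·0|²)³ dμ = ∫_𝔻 (1 - |z|²) dA = π / 2`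
(`T5RuhlRadial.integral_ball_one_sub_norm_sq`), with `c = haarScalarFactor (nu haarCircle) μ > 0` —
in particular the coefficient function is `μ`-INTEGRABLE (the «`L¹ ∩ L²`» of P2′ / P3, for the
square) and its integral is the explicit positive number `π / (2c)`.

Blind lane: Mathlib + own prefix only; no sorry; axioms ⊆ {propext, Classical.choice, Quot.sound}.
-/

namespace Summit.Ventures.HodgeRepro2.T5SU11CoefficientL2

open MeasureTheory MeasureTheory.Measure Metric T5PoincareMeasure T5SU11Unimodular T5SU11Fibration
  T5SU11FibrationHaar T5SU11FibrationCartan T5HaarCircle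
open scoped ENNReal NNReal Real

/-- The square of the normalised matrix coefficient in the disc picture: `(1 - |g·0|²)³`. -/
noncomputable def coeffSq (g : SU11) : ℝ := (1 - ‖orbit g‖ ^ 2) ^ 3

/-- `coeffSq` is continuous. -/
lemma continuous_coeffSq : Continuous coeffSq := by
  unfold coeffSq
  exact (continuous_const.sub (continuous_orbit.norm.pow 2)).pow 3

/-- `coeffSq (s(z) · rot u) = (1 - |z|²)³` on the disc. -/
lemma coeffSq_fib {z : ℂ} (hz : z ∈ ball 0 1) (u : Circle) :
    coeffSq (fib (z, u)) = (1 - ‖z‖ ^ 2) ^ 3 := by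
  unfold coeffSq
  rw [orbit_fib hz u]

/-- The disc integrand `(1 - |z|²)⁻² · (1 - |z|²)³ = 1 - |z|²`. -/
lemma dens_mul_cube {z : ℂ} (hz : z ∈ ball 0 1) :
    dens z * (1 - ‖z‖ ^ 2) ^ 3 = 1 - ‖z‖ ^ 2 := by
  rw [dens_eq_norm]
  have h : 1 - ‖z‖ ^ 2 ≠ 0 := by
    have := mem_ball_zero_iff.mp hz
    have h2 : ‖z‖ ^ 2 < 1 := by nlinarith [norm_nonneg z]
    linarith
  field_simp

/-- `(1 - |z|²)³` is `poincare`-integrable (the density times it is `1 - |z|²` on the disc). -/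
lemma integrable_cube_poincare : Integrable (fun z : ℂ => (1 - ‖z‖ ^ 2) ^ 3) poincare := by
  have hd : Measurable fun z : ℂ => Real.toNNReal (dens z) := measurable_dens.real_toNNReal
  have e : poincare = (volume.restrict (ball 0 1)).withDensity
      fun z => ((Real.toNNReal (dens z) : ℝ≥0) : ℝ≥0∞) := rfl
  rw [e, integrable_withDensity_iff_integrable_smul hd]
  -- on the disc the integrand is `1 - ‖z‖²`, bounded and continuous on the compact closed disc
  have hcont : Continuous fun z : ℂ => 1 - ‖z‖ ^ 2 := by fun_prop
  have hint : IntegrableOn (fun z : ℂ => 1 - ‖z‖ ^ 2) (ball 0 1) :=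
    (hcont.continuousOn.integrableOn_compact (isCompact_closedBall (0 : ℂ) 1)).mono_set
      ball_subset_closedBall
  refine hint.congr_fun ?_ measurableSet_ball
  intro z hz
  simp only
  rw [NNReal.smul_def, Real.coe_toNNReal _ (dens_nonneg z), smul_eq_mul, dens_mul_cube hz]

variable [MeasurableSpace Circle] [BorelSpace Circle]

/-- **`coeffSq` is integrable against every Haar measure of `SU(1,1)`** (the «`L¹`» of the square
of the matrix coefficient): through `ν = c • μ` and the fibration. -/
theorem integrable_coeffSq (μ : Measure SU11) [IsHaarMeasure μ] : Integrable coeffSq μ := by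
  set c := haarScalarFactor (nu haarCircle) μ with hc
  have hc0 : c ≠ 0 := (haarScalarFactor_cartan_pos μ).ne'
  have hnu : nu haarCircle = c • μ := nu_eq_smul haarCircle μ
  have hmeas : AEStronglyMeasurable coeffSq (nu haarCircle) :=
    continuous_coeffSq.aestronglyMeasurable
  -- integrability against `ν`
  have hint_nu : Integrable coeffSq (nu haarCircle) := by
    rw [nu, integrable_map_measure (by rw [← nu]; exact hmeas) measurable_fib.aemeasurable]
    -- `coeffSq ∘ fib = (1 - |z|²)³` a.e. (the complement of the disc is `poincare`-null)
    have hae : (fun p : ℂ × Circle => (1 - ‖p.1‖ ^ 2) ^ 3) =ᵐ[poincare.prod haarCircle]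
        (coeffSq ∘ fib) := by
      have hnull : (poincare.prod haarCircle) ((ball (0 : ℂ) 1)ᶜ ×ˢ (Set.univ : Set Circle)) = 0 := by
        rw [Measure.prod_prod, poincare_compl_ball, zero_mul]
      rw [Filter.EventuallyEq, ae_iff]
      apply measure_mono_null _ hnull
      intro p hp
      simp only [Set.mem_setOf_eq] at hp
      refine ⟨?_, Set.mem_univ _⟩
      intro hball
      exact hp (by rw [Function.comp_apply, show fib p = fib (p.1, p.2) from rfl, coeffSq_fib hball])
    exact (integrable_cube_poincare.comp_fst haarCircle).congr hae
  rw [hnu] at hint_nu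
  exact (integrable_smul_measure (ENNReal.coe_ne_zero.mpr hc0) ENNReal.coe_ne_top).mp hint_nu

/-- **The `L²`-integral of the matrix coefficient**: for every Haar measure `μ` on `SU(1,1)`,
`c • ∫_G (1 - |g·0|²)³ dμ = π / 2` with `c = haarScalarFactor (nu haarCircle) μ > 0` —
the P2′ / P3 number `∫ cosh(η/2)⁻⁶ dg` in the disc picture. -/
theorem integral_coeffSq (μ : Measure SU11) [IsHaarMeasure μ] :
    (haarScalarFactor (nu haarCircle) μ : ℝ) • ∫ g, coeffSq g ∂μ = π / 2 := by
  rw [integral_eq haarCircle μ coeffSq (integrable_coeffSq μ)]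
  have h : ∀ z ∈ ball (0 : ℂ) 1,
      dens z • ∫ u, coeffSq (sec z * rot u) ∂haarCircle = 1 - ‖z‖ ^ 2 := by
    intro z hz
    have hin : ∀ u : Circle, coeffSq (sec z * rot u) = (1 - ‖z‖ ^ 2) ^ 3 := fun u => coeffSq_fib hz u
    simp_rw [hin]
    rw [integral_const, measureReal_def, haarCircle_univ, ENNReal.toReal_one, one_smul, smul_eq_mul,
      dens_mul_cube hz]
  rw [setIntegral_congr_fun measurableSet_ball h]
  exact T5RuhlRadial.integral_ball_one_sub_norm_sq

/-- The integral itself: `∫_G (1 - |g·0|²)³ dμ = π / (2c) > 0`. -/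
theorem integral_coeffSq_eq (μ : Measure SU11) [IsHaarMeasure μ] :
    ∫ g, coeffSq g ∂μ = π / (2 * (haarScalarFactor (nu haarCircle) μ : ℝ)) := by
  have hc : (haarScalarFactor (nu haarCircle) μ : ℝ) ≠ 0 := by
    exact_mod_cast (haarScalarFactor_cartan_pos μ).ne'
  have h := integral_coeffSq μ
  rw [smul_eq_mul] at h
  field_simp
  linarith [h]

/-- The integral is positive. -/
theorem integral_coeffSq_pos (μ : Measure SU11) [IsHaarMeasure μ] : 0 < ∫ g, coeffSq g ∂μ := by
  rw [integral_coeffSq_eq]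
  have : (0 : ℝ) < haarScalarFactor (nu haarCircle) μ := by
    exact_mod_cast haarScalarFactor_cartan_pos μ
  positivity

/-- Against the explicit measure `ν = Φ_* (poincare ⊗ haarCircle)` itself (`c = 1`):
`∫_G (1 - |g·0|²)³ dν = π / 2`. -/
theorem integral_coeffSq_nu : ∫ g, coeffSq g ∂(nu haarCircle) = π / 2 := by
  have h := integral_coeffSq (nu haarCircle)
  rw [haarScalarFactor_self, NNReal.coe_one, one_smul] at h
  exact h

/-- **Rühl's normalisation**: the Haar measure `μ_R := π⁻¹ • ν` — the one against which the
`L²`-integral of the lowest-weight-`3` coefficient is the printed value `½` (`2/(3p - 2)` at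
`p = 2`). -/
noncomputable def ruhl : Measure SU11 := ENNReal.ofReal π⁻¹ • nu haarCircle

/-- `μ_R` is a Haar measure. -/
instance instIsHaarMeasureRuhl : IsHaarMeasure ruhl :=
  IsHaarMeasure.smul _ (by positivity) ENNReal.ofReal_ne_top

/-- `∫_G (1 - |g·0|²)³ dμ_R = 1 / 2` — the printed value of `∫ cosh(η/2)⁻⁶ dg` for Rühl's measure
(`2/(3p - 2)` at `p = 2`), so THIS normalisation of the Haar measure is the one of the printed
formula (a consistency check of the normalisation; the identification with the print stays a
printed input). -/
theorem integral_coeffSq_ruhl : ∫ g, coeffSq g ∂ruhl = 1 / 2 := by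
  unfold ruhl
  rw [integral_smul_measure, integral_coeffSq_nu, ENNReal.toReal_ofReal (by positivity), smul_eq_mul]
  have hπ : π ≠ 0 := Real.pi_ne_zero
  field_simp

end Summit.Ventures.HodgeRepro2.T5SU11CoefficientL2
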